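import Mathlib.MeasureTheory.Measure.Lebesgue.Basic
import Mathlib.MeasureTheory.Group.Prod
import Mathlib.MeasureTheory.Integral.Bochner.Set
import Mathlib.MeasureTheory.Integral.Prod
import HarnessLib

/-!
# Route `FordMaynardSieveConst01651`, target `SieveConst01651` (stmt-Parity-19185), stub `stub_certValuePos` (R2):
# the swap symmetry of the plane

Def-free helper file (glue (Gc) of the `certP`/`certN` soundness, see `…CertAssembly`): the diagonal
`{y₁ = y₂}` is null for `volume.prod volume` on `ℝ × ℝ` (`prod_diag_eq_null`); for a swap-invariant set `S` and a
swap-invariant function `f`, the integrals over the two strict halves `S ∩ {y₂ < y₁}` and `S ∩ {y₁ < y₂}` agree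
(`setIntegral_swap_halves`, `Measure.measurePreserving_swap`), hence `∫_S f = 2 ∫_{S ∩ {y₁ ≤ y₂}} f`
(`setIntegral_symm_eq_two_mul`).  This is the `σ = 2` weight of the diagonal cells `a = b` of the `g₂` table.

References: folklore.
-/

noncomputable section

open MeasureTheory Set

namespace Summit.Parity.GeneralizedHardyLittlewood.FordMaynardSieveConst01651SieveConst01651

/-- The diagonal is null in the plane. [folklore] -/
theorem prod_diag_eq_null : ((volume : Measure ℝ).prod volume) {p : ℝ × ℝ | p.1 = p.2} = 0 := by
  have hm : MeasurableSet {p : ℝ × ℝ | p.1 = p.2} :=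
    measurableSet_eq_fun measurable_fst measurable_snd
  rw [Measure.prod_apply hm]
  have hsec : ∀ x : ℝ, volume (Prod.mk x ⁻¹' {p : ℝ × ℝ | p.1 = p.2}) = 0 := by
    intro x
    have : Prod.mk x ⁻¹' {p : ℝ × ℝ | p.1 = p.2} = {x} := by
      ext y
      simp only [Set.mem_preimage, Set.mem_setOf_eq, Set.mem_singleton_iff]
      exact ⟨fun h => h.symm, fun h => h.symm⟩
    rw [this, Real.volume_singleton]
  simp only [hsec, lintegral_zero]

/-- **Swap symmetry of the two strict halves.**  For a swap-invariant set `S` and a swap-invariant `f`,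
`∫_{S ∩ {y₂ < y₁}} f = ∫_{S ∩ {y₁ < y₂}} f`. [folklore] -/
theorem setIntegral_swap_halves {S : Set (ℝ × ℝ)} (hS : ∀ p : ℝ × ℝ, p ∈ S ↔ p.swap ∈ S)
    {f : ℝ × ℝ → ℝ} (hf : ∀ p : ℝ × ℝ, f p.swap = f p) :
    ∫ p in S ∩ {p | p.2 < p.1}, f p ∂((volume : Measure ℝ).prod volume) =
      ∫ p in S ∩ {p | p.1 < p.2}, f p ∂((volume : Measure ℝ).prod volume) := by
  have hmp : MeasurePreserving (Prod.swap : ℝ × ℝ → ℝ × ℝ) ((volume : Measure ℝ).prod volume)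
      ((volume : Measure ℝ).prod volume) := Measure.measurePreserving_swap
  have hemb : MeasurableEmbedding (Prod.swap : ℝ × ℝ → ℝ × ℝ) :=
    MeasurableEquiv.prodComm.measurableEmbedding
  have h := hmp.setIntegral_preimage_emb hemb f (S ∩ {p | p.1 < p.2})
  have hpre : (Prod.swap : ℝ × ℝ → ℝ × ℝ) ⁻¹' (S ∩ {p : ℝ × ℝ | p.1 < p.2}) = S ∩ {p | p.2 < p.1} := by
    ext p
    simp only [Set.mem_preimage, Set.mem_inter_iff, Set.mem_setOf_eq, Prod.fst_swap, Prod.snd_swap]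
    rw [← hS p]
  rw [hpre] at h
  simp_rw [hf] at h
  exact h

/-- **A swap-invariant integral is twice the integral over the closed half `y₁ ≤ y₂`.** [folklore] -/
theorem setIntegral_symm_eq_two_mul {S : Set (ℝ × ℝ)} (hS : ∀ p : ℝ × ℝ, p ∈ S ↔ p.swap ∈ S)
    {f : ℝ × ℝ → ℝ} (hf : ∀ p : ℝ × ℝ, f p.swap = f p)
    (hfi : IntegrableOn f S ((volume : Measure ℝ).prod volume)) :
    ∫ p in S, f p ∂((volume : Measure ℝ).prod volume) =
      2 * ∫ p in S ∩ {p | p.1 ≤ p.2}, f p ∂((volume : Measure ℝ).prod volume) := by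
  have hle : MeasurableSet {p : ℝ × ℝ | p.1 ≤ p.2} := measurableSet_le measurable_fst measurable_snd
  have h1 := integral_inter_add_sdiff hle hfi
  have hdiff : S \ {p : ℝ × ℝ | p.1 ≤ p.2} = S ∩ {p | p.2 < p.1} := by
    ext p
    simp only [Set.mem_sdiff, Set.mem_setOf_eq, not_le, Set.mem_inter_iff]
  rw [hdiff, setIntegral_swap_halves hS hf] at h1
  have hae : (S ∩ {p : ℝ × ℝ | p.1 < p.2} : Set (ℝ × ℝ)) =ᵐ[((volume : Measure ℝ).prod volume)]
      (S ∩ {p : ℝ × ℝ | p.1 ≤ p.2} : Set (ℝ × ℝ)) := by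
    refine ae_eq_set.2 ⟨?_, ?_⟩
    · have hsub : S ∩ {p : ℝ × ℝ | p.1 < p.2} ⊆ S ∩ {p : ℝ × ℝ | p.1 ≤ p.2} :=
        fun p hp => ⟨hp.1, show p.1 ≤ p.2 from le_of_lt hp.2⟩
      rw [Set.sdiff_eq_empty.2 hsub]; exact measure_empty
    · refine measure_mono_null (fun p hp => ?_) prod_diag_eq_null
      simp only [Set.mem_sdiff, Set.mem_inter_iff, Set.mem_setOf_eq, not_and, not_lt] at hp
      show p.1 = p.2
      exact le_antisymm hp.1.2 (hp.2 hp.1.1)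
  rw [setIntegral_congr_set hae] at h1
  linarith

end Summit.Parity.GeneralizedHardyLittlewood.FordMaynardSieveConst01651SieveConst01651

end
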